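import Literature.Computability.Complexity.StackItemLists
import HarnessLib

/-!
# Word-RAM programs on multi-stack machines, I: the register file and the memory log

Family `fine-grained` / trunk `CplxCore`. First part of an interpreter of the word RAM of
`Literature/Computability/Cryptography/WordRAM.lean` by structured stack programs (`Com`,
`StackPrograms.lean`), hence (`StackMachinesTM2.lean`) by Mathlib's multi-stack Turing machines
`Turing.FinTM2` — the machine-model step `sparseKSATInExpTime_of_liberalSparseKSATInRAMTime` of the
Turing-machine route to `Literature.Computability.FineGrained.not_kClique_inTimeInst_of_eth`
(`CliqueETHTMBridge.lean`): a word-RAM algorithm running in time `T` is simulated in time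
`poly(T, ·)` on a multitape/multi-stack machine, the memory being kept as the list of the pairs
(address, contents) written so far (Cook–Reckhow 1973, §2; Korte–Vygen 2002, §15.2, p. 341).

* `K`, `St`, `St.regs` — the main register file of the whole interpreter (memory and scan state,
  the outer registers of the word operations of `StackWordArith.lean`, control, front end), by
  name, with the `Function.update` simp-normal form `{ ρ with r := v }.regs`; the arithmetic bank
  `AReg` sits on the right of the sum `K ⊕ AReg` (`state ρ F`).
* `encLog` — the **memory log**: a register holding, newest first, for each write an entry made of
  two self-delimiting items (`encItem` of `StackItemLists.lean`): the key (address numeral, stored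
  so as to be streamed least significant bit first) and the value (streamed most significant bit
  first); `logLookup` — the value of the newest entry with a given key, `[]` if none;
  `Represents E mem` — the log `E` holds `encodeNat (mem a)` under the key `encodeNat a` for every
  address (`Represents.update`: writing is prepending).
* `memWrite` / `runs_memWrite` — prepend the entry `(key, x)` (`pushItemG`, a generic tagged push),
  `O(|key| + |x|)` steps.
* `memRead` / `runs_memRead` — **one scan of the log** computes `logLookup`: the log is popped bit
  by bit onto `mem2` (and poured back at the end), the two-bits-per-bit code being decoded by the
  flags `st1`/`st2`, key items (`ph = []`) compared bit by bit with the target consumed into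
  `key2` and restored at the end of the item (`keyCmp`, `keyCmp_and_isEmpty`: the comparison
  followed by the length check decides equality), value items (`ph = [1]`) collected on `val` iff
  the key matched (`eqf`) and no earlier entry did (`found`). Proof architecture: the loop body
  case by case (`runs_scanBody_tag`, `runs_dataBit_key/val`, `runs_termBit_key/val`), then
  segments in continuation-passing form (`scan_keyBits`, `scan_valBits`, `scan_entry`,
  `scan_log`). Cost `|encLog E| · (3 |key| + 17) + 9`.
* `BoundedLog`, `length_encLog_le` — size bookkeeping for the running-time analysis.

## References

* S. A. Cook, R. A. Reckhow, *Time bounded random access machines*, JCSS 7 (1973) 354–375, §2.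
* B. Korte, J. Vygen, *Combinatorial Optimization*, Springer 2002, §15.2, p. 341 (the memory of a
  random-access algorithm kept on a tape as the list of (index, value) pairs in binary; every
  operation a scan of that tape).
* S. Arora, B. Barak, *Computational Complexity: A Modern Approach*, CUP 2009, §0.1
  (self-delimiting codes), §1.3.
* T. Nipkow, G. Klein, *Concrete Semantics with Isabelle/HOL*, Springer 2014, §7.2 (big-step
  reasoning about loops).
-/

namespace Literature.Computability.Cryptography.WordRAM.ToTM2

open _root_.Computability Complexity Complexity.Com

/-- The main registers of the interpreter (the arithmetic bank `AReg` is added on the right of a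
sum): memory log and scan state, the outer registers of the word operations, control, and the
registers of the front end reading the token code of a `k`-CNF. [folklore] -/
inductive K where
  | mem | mem2 | key | key2 | val | st1 | st2 | ph | eqf | found | wr | cn | cn2 | msb | quo
  | scr | run | pc | tmp | inp | nrev | nrev2 | nb | un | tokc | adr | a0 | cl | mc | lit | he
  | incl | it1 | it2 | ifl | out
  deriving DecidableEq, Fintype, Repr

/-- The main register file by name. [folklore] -/
structure St where
  /-- the memory log -/
  mem : List Bool
  /-- the reversed log during a scan -/
  mem2 : List Bool
  /-- the target address of a memory access -/
  key : List Bool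
  /-- the consumed prefix of the target during a scan -/
  key2 : List Bool
  /-- the value read -/
  val : List Bool
  /-- scan state: a tag bit has been read -/
  st1 : List Bool
  /-- scan state: the tag announced a data bit -/
  st2 : List Bool
  /-- scan state: inside a value item -/
  ph : List Bool
  /-- scan flag: the current key matches so far -/
  eqf : List Bool
  /-- scan flag: a value has been read -/
  found : List Bool
  /-- the ruler `1^W` -/
  wr : List Bool
  /-- counter of the word operations -/
  cn : List Bool
  /-- second counter -/
  cn2 : List Bool
  /-- most-significant-bit-first operand -/
  msb : List Bool
  /-- quotient register -/
  quo : List Bool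
  /-- scratch of the word operations -/
  scr : List Bool
  /-- the run flag of the interpreter loop -/
  run : List Bool
  /-- the program counter, in unary -/
  pc : List Bool
  /-- scratch for moves -/
  tmp : List Bool
  /-- the input word (token code) -/
  inp : List Bool
  /-- the header bits, most significant on top -/
  nrev : List Bool
  /-- second copy of the header bits -/
  nrev2 : List Bool
  /-- the numeral of `n` -/
  nb : List Bool
  /-- the unary accumulator `1^n`, then `1^{n + #tokens + 1}` -/
  un : List Bool
  /-- the token counter -/
  tokc : List Bool
  /-- the address counter (numeral) -/
  adr : List Bool
  /-- the address reserved for the length of the current clause -/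
  a0 : List Bool
  /-- the length of the current clause (numeral) -/
  cl : List Bool
  /-- the clause counter (numeral) -/
  mc : List Bool
  /-- the literal being read -/
  lit : List Bool
  /-- flag: an empty clause was seen -/
  he : List Bool
  /-- flag: inside a clause -/
  incl : List Bool
  /-- scratch of the binary increment -/
  it1 : List Bool
  /-- scratch of the binary increment -/
  it2 : List Bool
  /-- flag of the binary increment -/
  ifl : List Bool
  /-- the output register -/
  out : List Bool

namespace St

/-- The all-empty main register file. [folklore] -/
def zero : St :=
  ⟨[], [], [], [], [], [], [], [], [], [], [], [], [], [], [], [], [], [], [], [],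
   [], [], [], [], [], [], [], [], [], [], [], [], [], [], [], []⟩

/-- register `mem` of the empty file. [folklore] -/
@[simp] theorem zero_mem : zero.mem = [] := rfl
/-- register `mem2` of the empty file. [folklore] -/
@[simp] theorem zero_mem2 : zero.mem2 = [] := rfl
/-- register `key` of the empty file. [folklore] -/
@[simp] theorem zero_key : zero.key = [] := rfl
/-- register `key2` of the empty file. [folklore] -/
@[simp] theorem zero_key2 : zero.key2 = [] := rfl
/-- register `val` of the empty file. [folklore] -/
@[simp] theorem zero_val : zero.val = [] := rfl
/-- register `st1` of the empty file. [folklore] -/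
@[simp] theorem zero_st1 : zero.st1 = [] := rfl
/-- register `st2` of the empty file. [folklore] -/
@[simp] theorem zero_st2 : zero.st2 = [] := rfl
/-- register `ph` of the empty file. [folklore] -/
@[simp] theorem zero_ph : zero.ph = [] := rfl
/-- register `eqf` of the empty file. [folklore] -/
@[simp] theorem zero_eqf : zero.eqf = [] := rfl
/-- register `found` of the empty file. [folklore] -/
@[simp] theorem zero_found : zero.found = [] := rfl
/-- register `wr` of the empty file. [folklore] -/
@[simp] theorem zero_wr : zero.wr = [] := rfl
/-- register `cn` of the empty file. [folklore] -/
@[simp] theorem zero_cn : zero.cn = [] := rfl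
/-- register `cn2` of the empty file. [folklore] -/
@[simp] theorem zero_cn2 : zero.cn2 = [] := rfl
/-- register `msb` of the empty file. [folklore] -/
@[simp] theorem zero_msb : zero.msb = [] := rfl
/-- register `quo` of the empty file. [folklore] -/
@[simp] theorem zero_quo : zero.quo = [] := rfl
/-- register `scr` of the empty file. [folklore] -/
@[simp] theorem zero_scr : zero.scr = [] := rfl
/-- register `run` of the empty file. [folklore] -/
@[simp] theorem zero_run : zero.run = [] := rfl
/-- register `pc` of the empty file. [folklore] -/
@[simp] theorem zero_pc : zero.pc = [] := rfl
/-- register `tmp` of the empty file. [folklore] -/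
@[simp] theorem zero_tmp : zero.tmp = [] := rfl
/-- register `inp` of the empty file. [folklore] -/
@[simp] theorem zero_inp : zero.inp = [] := rfl
/-- register `nrev` of the empty file. [folklore] -/
@[simp] theorem zero_nrev : zero.nrev = [] := rfl
/-- register `nrev2` of the empty file. [folklore] -/
@[simp] theorem zero_nrev2 : zero.nrev2 = [] := rfl
/-- register `nb` of the empty file. [folklore] -/
@[simp] theorem zero_nb : zero.nb = [] := rfl
/-- register `un` of the empty file. [folklore] -/
@[simp] theorem zero_un : zero.un = [] := rfl
/-- register `tokc` of the empty file. [folklore] -/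
@[simp] theorem zero_tokc : zero.tokc = [] := rfl
/-- register `adr` of the empty file. [folklore] -/
@[simp] theorem zero_adr : zero.adr = [] := rfl
/-- register `a0` of the empty file. [folklore] -/
@[simp] theorem zero_a0 : zero.a0 = [] := rfl
/-- register `cl` of the empty file. [folklore] -/
@[simp] theorem zero_cl : zero.cl = [] := rfl
/-- register `mc` of the empty file. [folklore] -/
@[simp] theorem zero_mc : zero.mc = [] := rfl
/-- register `lit` of the empty file. [folklore] -/
@[simp] theorem zero_lit : zero.lit = [] := rfl
/-- register `he` of the empty file. [folklore] -/
@[simp] theorem zero_he : zero.he = [] := rfl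
/-- register `incl` of the empty file. [folklore] -/
@[simp] theorem zero_incl : zero.incl = [] := rfl
/-- register `it1` of the empty file. [folklore] -/
@[simp] theorem zero_it1 : zero.it1 = [] := rfl
/-- register `it2` of the empty file. [folklore] -/
@[simp] theorem zero_it2 : zero.it2 = [] := rfl
/-- register `ifl` of the empty file. [folklore] -/
@[simp] theorem zero_ifl : zero.ifl = [] := rfl
/-- register `out` of the empty file. [folklore] -/
@[simp] theorem zero_out : zero.out = [] := rfl

/-- A named main register file as a function (`ρ.regs`). [folklore] -/
def regs (ρ : St) : Regs K
  | .mem => ρ.mem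
  | .mem2 => ρ.mem2
  | .key => ρ.key
  | .key2 => ρ.key2
  | .val => ρ.val
  | .st1 => ρ.st1
  | .st2 => ρ.st2
  | .ph => ρ.ph
  | .eqf => ρ.eqf
  | .found => ρ.found
  | .wr => ρ.wr
  | .cn => ρ.cn
  | .cn2 => ρ.cn2
  | .msb => ρ.msb
  | .quo => ρ.quo
  | .scr => ρ.scr
  | .run => ρ.run
  | .pc => ρ.pc
  | .tmp => ρ.tmp
  | .inp => ρ.inp
  | .nrev => ρ.nrev
  | .nrev2 => ρ.nrev2
  | .nb => ρ.nb
  | .un => ρ.un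
  | .tokc => ρ.tokc
  | .adr => ρ.adr
  | .a0 => ρ.a0
  | .cl => ρ.cl
  | .mc => ρ.mc
  | .lit => ρ.lit
  | .he => ρ.he
  | .incl => ρ.incl
  | .it1 => ρ.it1
  | .it2 => ρ.it2
  | .ifl => ρ.ifl
  | .out => ρ.out

/-- reading register `mem`. [folklore] -/
@[simp] theorem regs_mem (ρ : St) : ρ.regs .mem = ρ.mem := rfl
/-- reading register `mem2`. [folklore] -/
@[simp] theorem regs_mem2 (ρ : St) : ρ.regs .mem2 = ρ.mem2 := rfl
/-- reading register `key`. [folklore] -/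
@[simp] theorem regs_key (ρ : St) : ρ.regs .key = ρ.key := rfl
/-- reading register `key2`. [folklore] -/
@[simp] theorem regs_key2 (ρ : St) : ρ.regs .key2 = ρ.key2 := rfl
/-- reading register `val`. [folklore] -/
@[simp] theorem regs_val (ρ : St) : ρ.regs .val = ρ.val := rfl
/-- reading register `st1`. [folklore] -/
@[simp] theorem regs_st1 (ρ : St) : ρ.regs .st1 = ρ.st1 := rfl
/-- reading register `st2`. [folklore] -/
@[simp] theorem regs_st2 (ρ : St) : ρ.regs .st2 = ρ.st2 := rfl
/-- reading register `ph`. [folklore] -/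
@[simp] theorem regs_ph (ρ : St) : ρ.regs .ph = ρ.ph := rfl
/-- reading register `eqf`. [folklore] -/
@[simp] theorem regs_eqf (ρ : St) : ρ.regs .eqf = ρ.eqf := rfl
/-- reading register `found`. [folklore] -/
@[simp] theorem regs_found (ρ : St) : ρ.regs .found = ρ.found := rfl
/-- reading register `wr`. [folklore] -/
@[simp] theorem regs_wr (ρ : St) : ρ.regs .wr = ρ.wr := rfl
/-- reading register `cn`. [folklore] -/
@[simp] theorem regs_cn (ρ : St) : ρ.regs .cn = ρ.cn := rfl
/-- reading register `cn2`. [folklore] -/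
@[simp] theorem regs_cn2 (ρ : St) : ρ.regs .cn2 = ρ.cn2 := rfl
/-- reading register `msb`. [folklore] -/
@[simp] theorem regs_msb (ρ : St) : ρ.regs .msb = ρ.msb := rfl
/-- reading register `quo`. [folklore] -/
@[simp] theorem regs_quo (ρ : St) : ρ.regs .quo = ρ.quo := rfl
/-- reading register `scr`. [folklore] -/
@[simp] theorem regs_scr (ρ : St) : ρ.regs .scr = ρ.scr := rfl
/-- reading register `run`. [folklore] -/
@[simp] theorem regs_run (ρ : St) : ρ.regs .run = ρ.run := rfl
/-- reading register `pc`. [folklore] -/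
@[simp] theorem regs_pc (ρ : St) : ρ.regs .pc = ρ.pc := rfl
/-- reading register `tmp`. [folklore] -/
@[simp] theorem regs_tmp (ρ : St) : ρ.regs .tmp = ρ.tmp := rfl
/-- reading register `inp`. [folklore] -/
@[simp] theorem regs_inp (ρ : St) : ρ.regs .inp = ρ.inp := rfl
/-- reading register `nrev`. [folklore] -/
@[simp] theorem regs_nrev (ρ : St) : ρ.regs .nrev = ρ.nrev := rfl
/-- reading register `nrev2`. [folklore] -/
@[simp] theorem regs_nrev2 (ρ : St) : ρ.regs .nrev2 = ρ.nrev2 := rfl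
/-- reading register `nb`. [folklore] -/
@[simp] theorem regs_nb (ρ : St) : ρ.regs .nb = ρ.nb := rfl
/-- reading register `un`. [folklore] -/
@[simp] theorem regs_un (ρ : St) : ρ.regs .un = ρ.un := rfl
/-- reading register `tokc`. [folklore] -/
@[simp] theorem regs_tokc (ρ : St) : ρ.regs .tokc = ρ.tokc := rfl
/-- reading register `adr`. [folklore] -/
@[simp] theorem regs_adr (ρ : St) : ρ.regs .adr = ρ.adr := rfl
/-- reading register `a0`. [folklore] -/
@[simp] theorem regs_a0 (ρ : St) : ρ.regs .a0 = ρ.a0 := rfl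
/-- reading register `cl`. [folklore] -/
@[simp] theorem regs_cl (ρ : St) : ρ.regs .cl = ρ.cl := rfl
/-- reading register `mc`. [folklore] -/
@[simp] theorem regs_mc (ρ : St) : ρ.regs .mc = ρ.mc := rfl
/-- reading register `lit`. [folklore] -/
@[simp] theorem regs_lit (ρ : St) : ρ.regs .lit = ρ.lit := rfl
/-- reading register `he`. [folklore] -/
@[simp] theorem regs_he (ρ : St) : ρ.regs .he = ρ.he := rfl
/-- reading register `incl`. [folklore] -/
@[simp] theorem regs_incl (ρ : St) : ρ.regs .incl = ρ.incl := rfl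
/-- reading register `it1`. [folklore] -/
@[simp] theorem regs_it1 (ρ : St) : ρ.regs .it1 = ρ.it1 := rfl
/-- reading register `it2`. [folklore] -/
@[simp] theorem regs_it2 (ρ : St) : ρ.regs .it2 = ρ.it2 := rfl
/-- reading register `ifl`. [folklore] -/
@[simp] theorem regs_ifl (ρ : St) : ρ.regs .ifl = ρ.ifl := rfl
/-- reading register `out`. [folklore] -/
@[simp] theorem regs_out (ρ : St) : ρ.regs .out = ρ.out := rfl

/-- updating register `mem`. [folklore] -/
@[simp] theorem update_regs_mem (ρ : St) (v : List Bool) :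
    Function.update ρ.regs .mem v = { ρ with mem := v }.regs := by
  funext i; cases i <;> rfl
/-- updating register `mem2`. [folklore] -/
@[simp] theorem update_regs_mem2 (ρ : St) (v : List Bool) :
    Function.update ρ.regs .mem2 v = { ρ with mem2 := v }.regs := by
  funext i; cases i <;> rfl
/-- updating register `key`. [folklore] -/
@[simp] theorem update_regs_key (ρ : St) (v : List Bool) :
    Function.update ρ.regs .key v = { ρ with key := v }.regs := by
  funext i; cases i <;> rfl
/-- updating register `key2`. [folklore] -/
@[simp] theorem update_regs_key2 (ρ : St) (v : List Bool) :
    Function.update ρ.regs .key2 v = { ρ with key2 := v }.regs := by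
  funext i; cases i <;> rfl
/-- updating register `val`. [folklore] -/
@[simp] theorem update_regs_val (ρ : St) (v : List Bool) :
    Function.update ρ.regs .val v = { ρ with val := v }.regs := by
  funext i; cases i <;> rfl
/-- updating register `st1`. [folklore] -/
@[simp] theorem update_regs_st1 (ρ : St) (v : List Bool) :
    Function.update ρ.regs .st1 v = { ρ with st1 := v }.regs := by
  funext i; cases i <;> rfl
/-- updating register `st2`. [folklore] -/
@[simp] theorem update_regs_st2 (ρ : St) (v : List Bool) :
    Function.update ρ.regs .st2 v = { ρ with st2 := v }.regs := by
  funext i; cases i <;> rfl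
/-- updating register `ph`. [folklore] -/
@[simp] theorem update_regs_ph (ρ : St) (v : List Bool) :
    Function.update ρ.regs .ph v = { ρ with ph := v }.regs := by
  funext i; cases i <;> rfl
/-- updating register `eqf`. [folklore] -/
@[simp] theorem update_regs_eqf (ρ : St) (v : List Bool) :
    Function.update ρ.regs .eqf v = { ρ with eqf := v }.regs := by
  funext i; cases i <;> rfl
/-- updating register `found`. [folklore] -/
@[simp] theorem update_regs_found (ρ : St) (v : List Bool) :
    Function.update ρ.regs .found v = { ρ with found := v }.regs := by
  funext i; cases i <;> rfl
/-- updating register `wr`. [folklore] -/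
@[simp] theorem update_regs_wr (ρ : St) (v : List Bool) :
    Function.update ρ.regs .wr v = { ρ with wr := v }.regs := by
  funext i; cases i <;> rfl
/-- updating register `cn`. [folklore] -/
@[simp] theorem update_regs_cn (ρ : St) (v : List Bool) :
    Function.update ρ.regs .cn v = { ρ with cn := v }.regs := by
  funext i; cases i <;> rfl
/-- updating register `cn2`. [folklore] -/
@[simp] theorem update_regs_cn2 (ρ : St) (v : List Bool) :
    Function.update ρ.regs .cn2 v = { ρ with cn2 := v }.regs := by
  funext i; cases i <;> rfl
/-- updating register `msb`. [folklore] -/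
@[simp] theorem update_regs_msb (ρ : St) (v : List Bool) :
    Function.update ρ.regs .msb v = { ρ with msb := v }.regs := by
  funext i; cases i <;> rfl
/-- updating register `quo`. [folklore] -/
@[simp] theorem update_regs_quo (ρ : St) (v : List Bool) :
    Function.update ρ.regs .quo v = { ρ with quo := v }.regs := by
  funext i; cases i <;> rfl
/-- updating register `scr`. [folklore] -/
@[simp] theorem update_regs_scr (ρ : St) (v : List Bool) :
    Function.update ρ.regs .scr v = { ρ with scr := v }.regs := by
  funext i; cases i <;> rfl
/-- updating register `run`. [folklore] -/
@[simp] theorem update_regs_run (ρ : St) (v : List Bool) :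
    Function.update ρ.regs .run v = { ρ with run := v }.regs := by
  funext i; cases i <;> rfl
/-- updating register `pc`. [folklore] -/
@[simp] theorem update_regs_pc (ρ : St) (v : List Bool) :
    Function.update ρ.regs .pc v = { ρ with pc := v }.regs := by
  funext i; cases i <;> rfl
/-- updating register `tmp`. [folklore] -/
@[simp] theorem update_regs_tmp (ρ : St) (v : List Bool) :
    Function.update ρ.regs .tmp v = { ρ with tmp := v }.regs := by
  funext i; cases i <;> rfl
/-- updating register `inp`. [folklore] -/
@[simp] theorem update_regs_inp (ρ : St) (v : List Bool) :
    Function.update ρ.regs .inp v = { ρ with inp := v }.regs := by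
  funext i; cases i <;> rfl
/-- updating register `nrev`. [folklore] -/
@[simp] theorem update_regs_nrev (ρ : St) (v : List Bool) :
    Function.update ρ.regs .nrev v = { ρ with nrev := v }.regs := by
  funext i; cases i <;> rfl
/-- updating register `nrev2`. [folklore] -/
@[simp] theorem update_regs_nrev2 (ρ : St) (v : List Bool) :
    Function.update ρ.regs .nrev2 v = { ρ with nrev2 := v }.regs := by
  funext i; cases i <;> rfl
/-- updating register `nb`. [folklore] -/
@[simp] theorem update_regs_nb (ρ : St) (v : List Bool) :
    Function.update ρ.regs .nb v = { ρ with nb := v }.regs := by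
  funext i; cases i <;> rfl
/-- updating register `un`. [folklore] -/
@[simp] theorem update_regs_un (ρ : St) (v : List Bool) :
    Function.update ρ.regs .un v = { ρ with un := v }.regs := by
  funext i; cases i <;> rfl
/-- updating register `tokc`. [folklore] -/
@[simp] theorem update_regs_tokc (ρ : St) (v : List Bool) :
    Function.update ρ.regs .tokc v = { ρ with tokc := v }.regs := by
  funext i; cases i <;> rfl
/-- updating register `adr`. [folklore] -/
@[simp] theorem update_regs_adr (ρ : St) (v : List Bool) :
    Function.update ρ.regs .adr v = { ρ with adr := v }.regs := by
  funext i; cases i <;> rfl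
/-- updating register `a0`. [folklore] -/
@[simp] theorem update_regs_a0 (ρ : St) (v : List Bool) :
    Function.update ρ.regs .a0 v = { ρ with a0 := v }.regs := by
  funext i; cases i <;> rfl
/-- updating register `cl`. [folklore] -/
@[simp] theorem update_regs_cl (ρ : St) (v : List Bool) :
    Function.update ρ.regs .cl v = { ρ with cl := v }.regs := by
  funext i; cases i <;> rfl
/-- updating register `mc`. [folklore] -/
@[simp] theorem update_regs_mc (ρ : St) (v : List Bool) :
    Function.update ρ.regs .mc v = { ρ with mc := v }.regs := by
  funext i; cases i <;> rfl
/-- updating register `lit`. [folklore] -/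
@[simp] theorem update_regs_lit (ρ : St) (v : List Bool) :
    Function.update ρ.regs .lit v = { ρ with lit := v }.regs := by
  funext i; cases i <;> rfl
/-- updating register `he`. [folklore] -/
@[simp] theorem update_regs_he (ρ : St) (v : List Bool) :
    Function.update ρ.regs .he v = { ρ with he := v }.regs := by
  funext i; cases i <;> rfl
/-- updating register `incl`. [folklore] -/
@[simp] theorem update_regs_incl (ρ : St) (v : List Bool) :
    Function.update ρ.regs .incl v = { ρ with incl := v }.regs := by
  funext i; cases i <;> rfl
/-- updating register `it1`. [folklore] -/
@[simp] theorem update_regs_it1 (ρ : St) (v : List Bool) :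
    Function.update ρ.regs .it1 v = { ρ with it1 := v }.regs := by
  funext i; cases i <;> rfl
/-- updating register `it2`. [folklore] -/
@[simp] theorem update_regs_it2 (ρ : St) (v : List Bool) :
    Function.update ρ.regs .it2 v = { ρ with it2 := v }.regs := by
  funext i; cases i <;> rfl
/-- updating register `ifl`. [folklore] -/
@[simp] theorem update_regs_ifl (ρ : St) (v : List Bool) :
    Function.update ρ.regs .ifl v = { ρ with ifl := v }.regs := by
  funext i; cases i <;> rfl
/-- updating register `out`. [folklore] -/
@[simp] theorem update_regs_out (ρ : St) (v : List Bool) :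
    Function.update ρ.regs .out v = { ρ with out := v }.regs := by
  funext i; cases i <;> rfl

/-- Every main register file is a `regs`. [folklore] -/
theorem eq_regs (R : Regs K) : R = St.regs
    ⟨R .mem, R .mem2, R .key, R .key2, R .val, R .st1, R .st2, R .ph, R .eqf, R .found, R .wr,
      R .cn, R .cn2, R .msb, R .quo, R .scr, R .run, R .pc, R .tmp, R .inp, R .nrev, R .nrev2,
      R .nb, R .un, R .tokc, R .adr, R .a0, R .cl, R .mc, R .lit, R .he, R .incl, R .it1, R .it2,
      R .ifl, R .out⟩ := by
  funext i; cases i <;> rfl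

end St

open St

/-! ### States of the whole register file -/

/-- A state of the interpreter: the main registers `ρ.regs` and the arithmetic bank `F`. [folklore] -/
abbrev state (ρ : St) (F : Regs AReg) : Regs (K ⊕ AReg) := Sum.elim ρ.regs F

/-- Updating a main register of a state. [folklore] -/
@[simp] theorem update_state_inl (ρ : St) (F : Regs AReg) (r : K) (v : List Bool) :
    Function.update (state ρ F) (Sum.inl r) v = Sum.elim (Function.update ρ.regs r v) F :=
  Sum.update_elim_inl

/-- Updating a bank register of a state. [folklore] -/
@[simp] theorem update_state_inr (ρ : St) (F : Regs AReg) (r : AReg) (v : List Bool) :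
    Function.update (state ρ F) (Sum.inr r) v = Sum.elim ρ.regs (Function.update F r v) :=
  Sum.update_elim_inr

/-! ### The memory log -/

/-- The code of a memory log: for each entry (key, value), the key item with the key stored in
reading order (so that a scan streams it least significant bit first) and terminator bit `0`,
then the value item (streamed most significant bit first) with terminator bit `1`; newest entry
on top. [folklore] -/
def encLog : List (List Bool × List Bool) → List Bool
  | [] => []
  | e :: E => encItem e.1.reverse false ++ encItem e.2 true ++ encLog E

/-- `encLog` of a cons. [folklore] -/
@[simp] theorem encLog_cons (e : List Bool × List Bool) (E : List (List Bool × List Bool)) :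
    encLog (e :: E) = encItem e.1.reverse false ++ encItem e.2 true ++ encLog E := rfl

/-- `encLog` of nil. [folklore] -/
@[simp] theorem encLog_nil : encLog [] = [] := rfl

/-- Length of a log code. [folklore] -/
theorem length_encLog (E : List (List Bool × List Bool)) :
    (encLog E).length = (E.map fun e => 2 * e.1.length + 2 * e.2.length + 4).sum := by
  induction E with
  | nil => rfl
  | cons e E ih => simp [ih]; omega

/-- Lookup in a log: the value of the first (newest) entry with the given key, `[]` (zero) if
none. [folklore] -/
def logLookup : List (List Bool × List Bool) → List Bool → List Bool
  | [], _ => []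
  | e :: E, k => if e.1 = k then e.2 else logLookup E k

/-! ### Pushing an item -/

section Generic

variable {ι : Type} [DecidableEq ι]

/-- The tagging loop: pop `src` bit by bit, pushing `bit, 1` on `dst`. [folklore] -/
def tagLoop (src dst : ι) : Com ι := loop src (push dst true ;; push dst true) (push dst false ;; push dst true)

/-- Effect of the tagging loop: `dst := (src.reverse.flatMap [1, ·]) ++ dst`, `src` emptied, cost
`4|src| + 1`. [folklore] -/
theorem runs_tagLoop {src dst : ι} (h : src ≠ dst) : ∀ (v : List Bool) (R : Regs ι), R src = v →
    Runs (tagLoop src dst) R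
      (Function.update (Function.update R src []) dst ((v.reverse.flatMap fun b => [true, b]) ++ R dst))
      (4 * v.length + 1)
  | [], R, hR => by
    refine (Runs.loop_nil _ _ hR).of_eq ?_ (by simp)
    ext i : 1
    simp only [Function.update_apply]
    split_ifs <;> simp_all
  | b :: v, R, hR => by
    have hbody : ∀ b' : Bool, Runs (push dst b' ;; push dst true) (Function.update R src v)
        (Function.update (Function.update R src v) dst (true :: b' :: R dst)) (1 + 1) := fun b' => by
      refine ((Runs.push dst b' _).seq (Runs.push dst true _)).of_eq ?_ le_rfl
      simp [Function.update_of_ne h.symm]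
    have ih := fun b' : Bool => runs_tagLoop h v (Function.update (Function.update R src v) dst (true :: b' :: R dst))
      (by simp [Function.update_of_ne h])
    have hfin : ∀ b' : Bool, Function.update (Function.update (Function.update (Function.update R src v) dst
        (true :: b' :: R dst)) src []) dst ((v.reverse.flatMap fun b => [true, b]) ++
          (Function.update (Function.update R src v) dst (true :: b' :: R dst)) dst) =
        Function.update (Function.update R src []) dst (((b' :: v).reverse.flatMap fun b => [true, b]) ++ R dst) := by
      intro b'
      ext i : 1
      simp only [Function.update_apply]
      split_ifs <;> simp_all
    cases b
    · exact (Runs.loop_false hR (hbody false) ((ih false).of_eq (hfin false) le_rfl)).of_eq rfl (by simp; omega)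
    · exact (Runs.loop_true hR (hbody true) ((ih true).of_eq (hfin true) le_rfl)).of_eq rfl (by simp; omega)

/-- `pushItemG src dst s`: push the item `(src, s)` onto the list register `dst`, emptying `src`:
first the terminator, then the tagged payload. [folklore] -/
def pushItemG (src dst : ι) (s : Bool) : Com ι := push dst s ;; push dst false ;; tagLoop src dst

/-- Effect of `pushItemG`: `dst := encItem src s ++ dst`, `src` emptied, cost `4|src| + 3`.
[folklore] -/
theorem runs_pushItemG {src dst : ι} (h : src ≠ dst) (s : Bool) (R : Regs ι) :
    Runs (pushItemG src dst s) R
      (Function.update (Function.update R src []) dst (encItem (R src) s ++ R dst)) (4 * (R src).length + 3) := by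
  have h1 := Runs.push dst s R
  have h2 := Runs.push dst false (Function.update R dst (s :: R dst))
  rw [Function.update_self, Function.update_idem] at h2
  have h3 := runs_tagLoop h (R src) (Function.update R dst (false :: s :: R dst)) (by simp [Function.update_of_ne h])
  refine (h1.seq (h2.seq h3)).of_eq ?_ ?_
  · ext i : 1
    simp only [encItem, Function.update_apply, List.append_assoc]
    split_ifs <;> simp_all
  · omega

end Generic

/-! ### Writing to the memory -/

/-- `memWrite`: prepend the entry `(key, x)` to the log: the value item from the bank register `x`,
then the key item from `key` poured (reversed) into `key2`; `x`, `key`, `key2` end empty. [folklore] -/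
def memWrite : Com (K ⊕ AReg) :=
  pushItemG (Sum.inr AReg.x) (Sum.inl K.mem) true ;;
  pour (Sum.inl K.key) (Sum.inl K.key2) ;;
  pushItemG (Sum.inl K.key2) (Sum.inl K.mem) false

/-- Effect of `memWrite` on a log, cost `≤ 7 (|key| + |x|) + 7`. [folklore] -/
theorem runs_memWrite (ρ : St) (E : List (List Bool × List Bool)) (k v y z s t u f g : List Bool)
    (hmem : ρ.mem = encLog E) (hkey : ρ.key = k) (hkey2 : ρ.key2 = []) :
    Runs memWrite (state ρ (AReg.file v y z s t u f g))
      (state { ρ with mem := encLog ((k, v) :: E), key := [], key2 := [] } (AReg.file [] y z s t u f g))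
      (7 * (k.length + v.length) + 7) := by
  have h1 := runs_pushItemG (src := (Sum.inr AReg.x : K ⊕ AReg)) (dst := Sum.inl K.mem) (by simp) true
    (state ρ (AReg.file v y z s t u f g))
  have h3 := h1.seq ((runs_pour (a := (Sum.inl K.key : K ⊕ AReg)) (b := Sum.inl K.key2) (by simp) _).seq
    (runs_pushItemG (src := (Sum.inl K.key2 : K ⊕ AReg)) (dst := Sum.inl K.mem) (by simp) false _))
  simp only [state, Sum.elim_inr, AReg.file_x, Sum.elim_inl, regs_mem, Sum.update_elim_inr, AReg.update_file_x,
    Sum.update_elim_inl, update_regs_mem, regs_key, regs_key2, update_regs_key, update_regs_key2,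
    List.length_reverse, List.length_append] at h3
  refine h3.of_eq ?_ ?_
  · simp [hmem, hkey, hkey2, encLog, List.append_assoc]
  · rw [hkey, hkey2]; simp; omega

/-! ### Reading from the memory: one scan of the log

The scan pops the log bit by bit onto `mem2` (restored at the end by one `pour`), decoding the
two-bits-per-bit item code with the state flags `st1` (a tag bit has been read) and `st2` (the
tag announced a data bit), alternating between key items (`ph = []`) and value items
(`ph = [1]`). During a key item the target key in `key` is consumed bit by bit into `key2` and
compared (`eqf` records agreement so far); at the end of the key item it is restored and the
lengths are compared. During a value item the bits are collected on `val` if the key matched and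
no value has been collected before (`found`). -/

/-- Key phase, data bit `b`: compare with the next bit of the target. [folklore] -/
def keyBit (b : Bool) : Com (K ⊕ AReg) :=
  pop (Sum.inl K.key)
    (push (Sum.inl K.key2) true ;; bif b then skip else clear (Sum.inl K.eqf))
    (push (Sum.inl K.key2) false ;; bif b then clear (Sum.inl K.eqf) else skip)
    (clear (Sum.inl K.eqf))

/-- A data bit `b`: in a value item collect it (if the key matched and nothing was found before),
in a key item compare it. [folklore] -/
def dataBit (b : Bool) : Com (K ⊕ AReg) :=
  pop (Sum.inl K.ph)
    (push (Sum.inl K.ph) true ;;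
      ifFlag (Sum.inl K.eqf) (ifFlag (Sum.inl K.found) skip (push (Sum.inl K.val) b)) skip)
    (push (Sum.inl K.ph) true ;;
      ifFlag (Sum.inl K.eqf) (ifFlag (Sum.inl K.found) skip (push (Sum.inl K.val) b)) skip)
    (keyBit b)

/-- End of a key item: the target must be exhausted too; restore it. [folklore] -/
def endKey : Com (K ⊕ AReg) :=
  push (Sum.inl K.ph) true ;;
  pop (Sum.inl K.key) (push (Sum.inl K.key) true ;; clear (Sum.inl K.eqf))
    (push (Sum.inl K.key) false ;; clear (Sum.inl K.eqf)) skip ;;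
  pour (Sum.inl K.key2) (Sum.inl K.key)

/-- End of a value item, i.e. of an entry: latch a match into `found`, re-arm `eqf`. [folklore] -/
def endEntry : Com (K ⊕ AReg) :=
  ifFlag (Sum.inl K.eqf) (ifFlag (Sum.inl K.found) skip (push (Sum.inl K.found) true)) skip ;;
  clear (Sum.inl K.eqf) ;; push (Sum.inl K.eqf) true

/-- A terminator bit: end of a key item or of a value item. [folklore] -/
def termBit : Com (K ⊕ AReg) :=
  pop (Sum.inl K.ph) endEntry endEntry endKey

/-- The second bit of a pair: data or terminator according to the tag. [folklore] -/
def afterTag (b : Bool) : Com (K ⊕ AReg) :=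
  pop (Sum.inl K.st2) (dataBit b) (dataBit b) termBit

/-- The body of the scan for the popped bit `b`: save it on `mem2`, then either record a tag or
process the second bit of a pair. [folklore] -/
def scanBody (b : Bool) : Com (K ⊕ AReg) :=
  push (Sum.inl K.mem2) b ;;
  pop (Sum.inl K.st1) (afterTag b) (afterTag b)
    (push (Sum.inl K.st1) true ;; bif b then push (Sum.inl K.st2) true else skip)

/-- The scan loop. [folklore] -/
def scanLoop : Com (K ⊕ AReg) := loop (Sum.inl K.mem) (scanBody true) (scanBody false)

/-- `memRead`: `val := logLookup mem key`, the log and the key preserved (from clean scan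
registers). [folklore] -/
def memRead : Com (K ⊕ AReg) :=
  push (Sum.inl K.eqf) true ;; scanLoop ;; pour (Sum.inl K.mem2) (Sum.inl K.mem) ;;
  clear (Sum.inl K.eqf) ;; clear (Sum.inl K.found)

/-! #### The body, case by case -/

/-- The simp set turning nested register updates of a state into a named state: a convenience
restatement of the update lemmas at the level of `state`. [folklore] -/
theorem state_def (ρ : St) (F : Regs AReg) : state ρ F = Sum.elim ρ.regs F := rfl

/-- Expecting a tag (`st1 = st2 = []`): record it — `st1 := [1]`, `st2 := flag b`. [folklore] -/
theorem runs_scanBody_tag (b : Bool) (ρ : St) (F : Regs AReg) (hst1 : ρ.st1 = []) (hst2 : ρ.st2 = []) :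
    Runs (scanBody b) (state ρ F)
      (state { ρ with mem2 := b :: ρ.mem2, st1 := [true], st2 := flag b } F) 5 := by
  have hk : (Function.update (state ρ F) (Sum.inl K.mem2) (b :: state ρ F (Sum.inl K.mem2))) (Sum.inl K.st1) = [] := by
    simp [state, hst1]
  cases b
  · refine ((Runs.push (Sum.inl K.mem2) false (state ρ F)).seq
      (Runs.pop_nil _ _ hk ((Runs.push (Sum.inl K.st1) true _).seq (Runs.skip _)))).of_eq ?_ (by norm_num)
    simp [state, hst1, hst2]
  · refine ((Runs.push (Sum.inl K.mem2) true (state ρ F)).seq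
      (Runs.pop_nil _ _ hk ((Runs.push (Sum.inl K.st1) true _).seq (Runs.push (Sum.inl K.st2) true _)))).of_eq ?_
      (by norm_num)
    simp [state, hst1, hst2]

/-- Inside a pair (`st1 = [1]`): save the bit, clear `st1`, continue with `afterTag`. [folklore] -/
theorem runs_scanBody_pair (b : Bool) (ρ : St) (F : Regs AReg) (hst1 : ρ.st1 = [true]) {R' : Regs (K ⊕ AReg)}
    {B : ℕ} (h : Runs (afterTag b) (state { ρ with mem2 := b :: ρ.mem2, st1 := [] } F) R' B) :
    Runs (scanBody b) (state ρ F) R' (1 + (B + 2)) := by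
  refine (Runs.push (Sum.inl K.mem2) b (state ρ F)).seq (Runs.pop_true' _ _ (w := []) ?_ ?_ h)
  · simp [state, hst1]
  · simp [state]

/-- After a tag `1` (`st2 = [1]`): a data bit. [folklore] -/
theorem runs_afterTag_data (b : Bool) (ρ : St) (F : Regs AReg) (hst2 : ρ.st2 = [true]) {R' : Regs (K ⊕ AReg)}
    {B : ℕ} (h : Runs (dataBit b) (state { ρ with st2 := [] } F) R' B) :
    Runs (afterTag b) (state ρ F) R' (B + 2) :=
  Runs.pop_true' _ _ (w := []) (by simp [state, hst2]) (by simp [state]) h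

/-- After a tag `0` (`st2 = []`): a terminator bit. [folklore] -/
theorem runs_afterTag_term (b : Bool) (ρ : St) (F : Regs AReg) (hst2 : ρ.st2 = []) {R' : Regs (K ⊕ AReg)}
    {B : ℕ} (h : Runs termBit (state ρ F) R' B) :
    Runs (afterTag b) (state ρ F) R' (B + 2) :=
  Runs.pop_nil _ _ (by simp [state, hst2]) h

/-- A data bit in a value item (`ph = [1]`): collect it iff `eqf` and not `found`. [folklore] -/
theorem runs_dataBit_val (b : Bool) (ρ : St) (F : Regs AReg) (hph : ρ.ph = [true]) {e fd : Bool}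
    (heqf : ρ.eqf = flag e) (hfound : ρ.found = flag fd) :
    Runs (dataBit b) (state ρ F)
      (state { ρ with val := bif e && !fd then b :: ρ.val else ρ.val } F) 13 := by
  have hcore : Runs (ifFlag (Sum.inl K.eqf) (ifFlag (Sum.inl K.found) skip (push (Sum.inl K.val) b)) skip)
      (state ρ F) (state { ρ with val := bif e && !fd then b :: ρ.val else ρ.val } F) (3 + 1 + 3 + 3) := by
    cases e
    · refine (runs_ifFlag_false _ (by simp [state, heqf]) (Runs.skip _)).of_eq ?_ (by norm_num)
      simp [state]
    · refine runs_ifFlag_true _ (by simp [state, heqf]) ?_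
      cases fd
      · refine (runs_ifFlag_false _ (by simp [state, hfound]) (Runs.push _ _ _)).of_eq ?_ (by norm_num)
        simp [state]
      · refine (runs_ifFlag_true _ (by simp [state, hfound]) (Runs.skip _)).of_eq ?_ (by norm_num)
        simp [state]
  have h1 : Runs (push (Sum.inl K.ph) true) (Function.update (state ρ F) (Sum.inl K.ph) []) (state ρ F) 1 :=
    Runs.push' (by simp [state, ← hph])
  refine (Runs.pop_true' _ _ (w := []) (by simp [state, hph]) rfl (h1.seq hcore)).of_eq rfl ?_
  norm_num

/-- Model of the key comparison, bit by bit: `e` records agreement so far, the entry key bits `ks`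
are matched against the remaining target `kr` (exhaustion of the target is a mismatch).
[folklore] -/
def keyCmp : Bool → List Bool → List Bool → Bool
  | e, [], _ => e
  | _, _ :: ks, [] => keyCmp false ks []
  | e, b :: ks, tb :: kr => keyCmp (e && (tb == b)) ks kr

/-- A data bit `b` in a key item (`ph = []`): one step of the comparison. [folklore] -/
theorem runs_dataBit_key (b : Bool) (ρ : St) (F : Regs AReg) (hph : ρ.ph = []) {e : Bool} (heqf : ρ.eqf = flag e) :
    Runs (dataBit b) (state ρ F)
      (state { ρ with key := ρ.key.tail, key2 := ρ.key.take 1 ++ ρ.key2, eqf := flag (keyCmp e [b] ρ.key) } F)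
      8 := by
  have hle : (state ρ F (Sum.inl K.eqf)).length ≤ 1 := by simp [state, heqf, length_flag_le]
  refine Runs.pop_nil _ _ (by simp [state, hph]) ?_
  -- `keyBit b`, within `6`
  rcases hk : ρ.key with _ | ⟨tb, kr⟩
  · -- target exhausted
    refine (Runs.pop_nil _ _ (by simp [state, hk]) (runs_clear_flag (Sum.inl K.eqf) hle)).of_eq ?_ (by norm_num)
    simp [state, hk, keyCmp, flag]
  · have hk' : state ρ F (Sum.inl K.key) = tb :: kr := by simp [state, hk]
    have hle' : ∀ t', (Function.update (Function.update (state ρ F) (Sum.inl K.key) kr) (Sum.inl K.key2)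
        (t' :: Function.update (state ρ F) (Sum.inl K.key) kr (Sum.inl K.key2)) (Sum.inl K.eqf)).length ≤ 1 := by
      intro t'; simp [state, heqf, length_flag_le]
    cases tb
    · cases b
      · refine (Runs.pop_false _ _ hk' ((Runs.push (Sum.inl K.key2) false _).seq (Runs.skip _))).of_eq ?_ (by norm_num)
        cases e <;> simp [state, keyCmp, flag, heqf]
      · refine (Runs.pop_false _ _ hk' ((Runs.push (Sum.inl K.key2) false _).seq
          (runs_clear_flag (Sum.inl K.eqf) (hle' false)))).of_eq ?_ (by norm_num)
        cases e <;> simp [state, keyCmp, flag, heqf]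
    · cases b
      · refine (Runs.pop_true _ _ hk' ((Runs.push (Sum.inl K.key2) true _).seq
          (runs_clear_flag (Sum.inl K.eqf) (hle' true)))).of_eq ?_ (by norm_num)
        cases e <;> simp [state, keyCmp, flag, heqf]
      · refine (Runs.pop_true _ _ hk' ((Runs.push (Sum.inl K.key2) true _).seq (Runs.skip _))).of_eq ?_ (by norm_num)
        cases e <;> simp [state, keyCmp, flag, heqf]

/-- A terminator bit at the end of a key item (`ph = []`): enter the value phase, compare the
lengths, restore the target. [folklore] -/
theorem runs_termBit_key (ρ : St) (F : Regs AReg) (hph : ρ.ph = []) {e : Bool} (heqf : ρ.eqf = flag e) :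
    Runs termBit (state ρ F)
      (state { ρ with ph := [true], eqf := flag (e && ρ.key.isEmpty), key := ρ.key2.reverse ++ ρ.key, key2 := [] } F)
      (3 * ρ.key2.length + 12) := by
  refine Runs.pop_nil _ _ (by simp [state, hph]) ?_
  -- `endKey`, within `3 |key2| + 10`
  have h1 := Runs.push (Sum.inl K.ph) true (state ρ F)
  have h3 : ∀ ρ' : St, Runs (pour (Sum.inl K.key2) (Sum.inl K.key)) (state ρ' F)
      (state { ρ' with key := ρ'.key2.reverse ++ ρ'.key, key2 := [] } F) (3 * ρ'.key2.length + 1) := fun ρ' => by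
    have := runs_pour (a := (Sum.inl K.key2 : K ⊕ AReg)) (b := Sum.inl K.key) (by simp) (state ρ' F)
    simpa [state] using this
  rcases hk : ρ.key with _ | ⟨tb, kr⟩
  · have h2 : Runs (pop (Sum.inl K.key) (push (Sum.inl K.key) true ;; clear (Sum.inl K.eqf))
        (push (Sum.inl K.key) false ;; clear (Sum.inl K.eqf)) skip)
        (Function.update (state ρ F) (Sum.inl K.ph) (true :: state ρ F (Sum.inl K.ph)))
        (state { ρ with ph := [true] } F) 2 :=
      (Runs.pop_nil _ _ (by simp [state, hk]) (Runs.skip _)).of_eq (by simp [state, hph]) (by norm_num)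
    refine (h1.seq (h2.seq (h3 _))).of_eq ?_ ?_
    · simp [hk, heqf]
    · simp; omega
  · have hk' : Function.update (state ρ F) (Sum.inl K.ph) (true :: state ρ F (Sum.inl K.ph)) (Sum.inl K.key) =
        tb :: kr := by simp [state, hk]
    have h2 : Runs (pop (Sum.inl K.key) (push (Sum.inl K.key) true ;; clear (Sum.inl K.eqf))
        (push (Sum.inl K.key) false ;; clear (Sum.inl K.eqf)) skip)
        (Function.update (state ρ F) (Sum.inl K.ph) (true :: state ρ F (Sum.inl K.ph)))
        (state { ρ with ph := [true], eqf := [] } F) (1 + 3 + 2) := by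
      have hle : ∀ R : Regs (K ⊕ AReg), R (Sum.inl K.eqf) = flag e → (R (Sum.inl K.eqf)).length ≤ 1 :=
        fun R h => by rw [h]; exact length_flag_le e
      cases tb
      · refine (Runs.pop_false _ _ hk' ((Runs.push (Sum.inl K.key) false _).seq
          (runs_clear_flag (Sum.inl K.eqf) (hle _ (by simp [state, heqf]))))).of_eq ?_ (by norm_num)
        simp [state, hph, hk]
      · refine (Runs.pop_true _ _ hk' ((Runs.push (Sum.inl K.key) true _).seq
          (runs_clear_flag (Sum.inl K.eqf) (hle _ (by simp [state, heqf]))))).of_eq ?_ (by norm_num)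
        simp [state, hph, hk]
    refine (h1.seq (h2.seq (h3 _))).of_eq ?_ ?_
    · simp [hk, flag]
    · simp; omega

/-- A terminator bit at the end of a value item (`ph = [1]`): the entry is over — latch a match,
re-arm `eqf`, back to the key phase. [folklore] -/
theorem runs_termBit_val (ρ : St) (F : Regs AReg) (hph : ρ.ph = [true]) {e fd : Bool}
    (heqf : ρ.eqf = flag e) (hfound : ρ.found = flag fd) :
    Runs termBit (state ρ F)
      (state { ρ with ph := [], found := flag (fd || e), eqf := [true] } F) 15 := by
  refine (Runs.pop_true' _ _ (w := []) (by simp [state, hph]) rfl ?_).of_eq rfl (show 13 + 2 ≤ 15 by norm_num)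
  -- `endEntry` from `ph := []`, within `13`
  set ρ₁ : St := { ρ with ph := [] } with hρ₁
  have e1 : Function.update (state ρ F) (Sum.inl K.ph) [] = state ρ₁ F := by simp [state, hρ₁]
  rw [e1]
  have h1 : Runs (ifFlag (Sum.inl K.eqf) (ifFlag (Sum.inl K.found) skip (push (Sum.inl K.found) true)) skip)
      (state ρ₁ F) (state { ρ₁ with found := flag (fd || e) } F) (1 + 3 + 3) := by
    cases e
    · refine (runs_ifFlag_false _ (by simp [state, hρ₁, heqf]) (Runs.skip _)).of_eq ?_ (by norm_num)
      simp [state, hρ₁, hfound]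
    · refine runs_ifFlag_true _ (by simp [state, hρ₁, heqf]) ?_
      cases fd
      · refine (runs_ifFlag_false _ (by simp [state, hρ₁, hfound]) (Runs.push _ _ _)).of_eq ?_ (by norm_num)
        simp [state, hρ₁, hfound]
      · refine (runs_ifFlag_true _ (by simp [state, hρ₁, hfound]) (Runs.skip _)).of_eq ?_ (by norm_num)
        simp [state, hρ₁, hfound]
  have h2 : Runs (clear (Sum.inl K.eqf)) (state { ρ₁ with found := flag (fd || e) } F)
      (state { ρ₁ with found := flag (fd || e), eqf := [] } F) 3 := by
    have := runs_clear_flag (Sum.inl K.eqf) (R := state { ρ₁ with found := flag (fd || e) } F)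
      (by simp [state, hρ₁, heqf, length_flag_le])
    simpa [state] using this
  have h3 := Runs.push (Sum.inl K.eqf) true (state { ρ₁ with found := flag (fd || e), eqf := [] } F)
  refine (h1.seq (h2.seq h3)).of_eq ?_ ?_
  · simp [state, hρ₁]
  · norm_num

/-! #### The comparison model -/

/-- A recorded mismatch stays. [folklore] -/
theorem keyCmp_false : ∀ (ks kr : List Bool), keyCmp false ks kr = false
  | [], _ => rfl
  | _ :: ks, [] => keyCmp_false ks []
  | _ :: ks, _ :: kr => by rw [keyCmp, Bool.false_and]; exact keyCmp_false ks kr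

/-- One bit, then the rest. [folklore] -/
theorem keyCmp_cons (e b : Bool) (ks kr : List Bool) :
    keyCmp e (b :: ks) kr = keyCmp (keyCmp e [b] kr) ks kr.tail := by
  cases kr with
  | nil => simp [keyCmp, keyCmp_false]
  | cons t kr => simp [keyCmp]

/-- **The bitwise comparison followed by the length check decides equality of the keys.**
[folklore] -/
theorem keyCmp_and_isEmpty : ∀ (e : Bool) (ks kr : List Bool),
    (keyCmp e ks kr && (kr.drop ks.length).isEmpty) = (e && decide (ks = kr))
  | e, [], kr => by cases kr <;> simp [keyCmp]
  | e, b :: ks, [] => by simp [keyCmp, keyCmp_false]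
  | e, b :: ks, t :: kr => by
    rw [keyCmp, List.length_cons, List.drop_succ_cons, keyCmp_and_isEmpty]
    cases e <;> cases b <;> cases t <;> simp

/-! #### Segments of the scan -/

/-- The tagged code of a payload. [folklore] -/
abbrev tagged (l : List Bool) : List Bool := l.flatMap fun b => [true, b]

/-- Dropping one more is dropping from the tail. [folklore] -/
theorem drop_succ_eq_tail_drop (l : List Bool) (n : ℕ) : l.drop (n + 1) = l.tail.drop n := by
  cases l <;> simp

/-- Taking one more, reversed. [folklore] -/
theorem reverse_take_succ (l acc : List Bool) (n : ℕ) :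
    (l.take (n + 1)).reverse ++ acc = (l.tail.take n).reverse ++ (l.take 1 ++ acc) := by
  cases l <;> simp

/-- **Key segment.** Scanning the tagged bits `ks` of an entry key in the key phase compares them
with the target (continuation form: `22` steps per payload bit). [folklore] -/
theorem scan_keyBits (F : Regs AReg) : ∀ (ks : List Bool) (ρ : St) (e : Bool) (rest : List Bool)
    (Rfin : Regs (K ⊕ AReg)) (Bc : ℕ),
    ρ.mem = tagged ks ++ rest → ρ.st1 = [] → ρ.st2 = [] → ρ.ph = [] → ρ.eqf = flag e →
    Runs scanLoop (state
      { ρ with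
        mem := rest, mem2 := (tagged ks).reverse ++ ρ.mem2
        key := ρ.key.drop ks.length, key2 := (ρ.key.take ks.length).reverse ++ ρ.key2
        eqf := flag (keyCmp e ks ρ.key) } F) Rfin Bc →
    Runs scanLoop (state ρ F) Rfin (ks.length * 22 + Bc)
  | [], ρ, e, rest, Rfin, Bc, hmem, hst1, hst2, hph, heqf, hcont => by
    have eρ : ({ ρ with
          mem := rest, mem2 := (tagged []).reverse ++ ρ.mem2, key := ρ.key.drop ([] : List Bool).length
          key2 := (ρ.key.take ([] : List Bool).length).reverse ++ ρ.key2
          eqf := flag (keyCmp e [] ρ.key) } : St) = ρ := by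
      cases ρ; simp only [keyCmp] at *; simp [hmem, heqf]
    rw [eρ] at hcont
    simpa using hcont
  | b :: ks, ρ, e, rest, Rfin, Bc, hmem, hst1, hst2, hph, heqf, hcont => by
    -- the tag bit
    have hk1 : state ρ F (Sum.inl K.mem) = true :: (b :: (tagged ks ++ rest)) := by simp [state, hmem]
    set ρ₁ : St := { ρ with mem := b :: (tagged ks ++ rest), mem2 := true :: ρ.mem2, st1 := [true], st2 := [true] }
      with hρ₁
    have h1 : Runs (scanBody true) (Function.update (state ρ F) (Sum.inl K.mem) (b :: (tagged ks ++ rest)))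
        (state ρ₁ F) 5 := by
      have := runs_scanBody_tag true { ρ with mem := b :: (tagged ks ++ rest) } F hst1 hst2
      simpa [state, hρ₁] using this
    -- the data bit
    have hk2 : state ρ₁ F (Sum.inl K.mem) = b :: (tagged ks ++ rest) := by simp [state, hρ₁]
    set ρ₂ : St := { ρ with
      mem := tagged ks ++ rest, mem2 := b :: true :: ρ.mem2, st1 := [], st2 := []
      key := ρ.key.tail, key2 := ρ.key.take 1 ++ ρ.key2, eqf := flag (keyCmp e [b] ρ.key) } with hρ₂
    have h2 : Runs (scanBody b) (Function.update (state ρ₁ F) (Sum.inl K.mem) (tagged ks ++ rest)) (state ρ₂ F)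
        (1 + ((8 + 2) + 2)) := by
      have hupd : Function.update (state ρ₁ F) (Sum.inl K.mem) (tagged ks ++ rest) =
          state { ρ₁ with mem := tagged ks ++ rest } F := by simp [state]
      rw [hupd]
      refine runs_scanBody_pair b _ F (by simp [hρ₁]) (runs_afterTag_data b _ F (by simp [hρ₁]) ?_)
      have := runs_dataBit_key b { ρ₁ with mem := tagged ks ++ rest, mem2 := b :: ρ₁.mem2, st1 := [], st2 := [] } F
        (by simp [hρ₁, hph]) (e := e) (by simp [hρ₁, heqf])
      simpa [state, hρ₁, hρ₂] using this
    -- the rest, by induction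
    have hih := scan_keyBits F ks ρ₂ (keyCmp e [b] ρ.key) rest Rfin Bc (by simp [hρ₂]) (by simp [hρ₂])
      (by simp [hρ₂]) (by simp [hρ₂, hph]) (by simp [hρ₂]) (by
        have e2 : ({ ρ₂ with
              mem := rest, mem2 := (tagged ks).reverse ++ ρ₂.mem2, key := ρ₂.key.drop ks.length
              key2 := (ρ₂.key.take ks.length).reverse ++ ρ₂.key2
              eqf := flag (keyCmp (keyCmp e [b] ρ.key) ks ρ₂.key) } : St) =
            { ρ with
              mem := rest, mem2 := (tagged (b :: ks)).reverse ++ ρ.mem2, key := ρ.key.drop (b :: ks).length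
              key2 := (ρ.key.take (b :: ks).length).reverse ++ ρ.key2
              eqf := flag (keyCmp e (b :: ks) ρ.key) } := by
          simp only [hρ₂, List.length_cons, drop_succ_eq_tail_drop, reverse_take_succ, keyCmp_cons e b ks ρ.key]
          simp [tagged, List.append_assoc, hst1, hst2]
        rw [e2]; exact hcont)
    have hstep2 : Runs scanLoop (state ρ₁ F) Rfin ((1 + ((8 + 2) + 2)) + 2 + (ks.length * 22 + Bc)) := by
      cases b
      · exact Runs.loop_false hk2 h2 hih
      · exact Runs.loop_true hk2 h2 hih
    exact (Runs.loop_true hk1 h1 hstep2).of_eq rfl (by simp; ring_nf; omega)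

/-- **Value segment.** Scanning the tagged bits `vs` of a value item collects them on `val` iff the
key matched and nothing was found before (`27` steps per payload bit). [folklore] -/
theorem scan_valBits (F : Regs AReg) : ∀ (vs : List Bool) (ρ : St) (e fd : Bool) (rest : List Bool)
    (Rfin : Regs (K ⊕ AReg)) (Bc : ℕ),
    ρ.mem = tagged vs ++ rest → ρ.st1 = [] → ρ.st2 = [] → ρ.ph = [true] → ρ.eqf = flag e → ρ.found = flag fd →
    Runs scanLoop (state
      { ρ with
        mem := rest, mem2 := (tagged vs).reverse ++ ρ.mem2
        val := (bif e && !fd then vs.reverse else []) ++ ρ.val } F) Rfin Bc →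
    Runs scanLoop (state ρ F) Rfin (vs.length * 27 + Bc)
  | [], ρ, e, fd, rest, Rfin, Bc, hmem, hst1, hst2, hph, heqf, hfound, hcont => by
    have eρ : ({ ρ with
          mem := rest, mem2 := (tagged []).reverse ++ ρ.mem2
          val := (bif e && !fd then ([] : List Bool).reverse else []) ++ ρ.val } : St) = ρ := by
      cases ρ; simp only at *; cases e <;> cases fd <;> simp [hmem]
    rw [eρ] at hcont
    simpa using hcont
  | b :: vs, ρ, e, fd, rest, Rfin, Bc, hmem, hst1, hst2, hph, heqf, hfound, hcont => by
    have hk1 : state ρ F (Sum.inl K.mem) = true :: (b :: (tagged vs ++ rest)) := by simp [state, hmem]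
    set ρ₁ : St := { ρ with mem := b :: (tagged vs ++ rest), mem2 := true :: ρ.mem2, st1 := [true], st2 := [true] }
      with hρ₁
    have h1 : Runs (scanBody true) (Function.update (state ρ F) (Sum.inl K.mem) (b :: (tagged vs ++ rest)))
        (state ρ₁ F) 5 := by
      have := runs_scanBody_tag true { ρ with mem := b :: (tagged vs ++ rest) } F hst1 hst2
      simpa [state, hρ₁] using this
    have hk2 : state ρ₁ F (Sum.inl K.mem) = b :: (tagged vs ++ rest) := by simp [state, hρ₁]
    set ρ₂ : St := { ρ with
      mem := tagged vs ++ rest, mem2 := b :: true :: ρ.mem2, st1 := [], st2 := []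
      val := bif e && !fd then b :: ρ.val else ρ.val } with hρ₂
    have h2 : Runs (scanBody b) (Function.update (state ρ₁ F) (Sum.inl K.mem) (tagged vs ++ rest)) (state ρ₂ F)
        (1 + ((13 + 2) + 2)) := by
      have hupd : Function.update (state ρ₁ F) (Sum.inl K.mem) (tagged vs ++ rest) =
          state { ρ₁ with mem := tagged vs ++ rest } F := by simp [state]
      rw [hupd]
      refine runs_scanBody_pair b _ F (by simp [hρ₁]) (runs_afterTag_data b _ F (by simp [hρ₁]) ?_)
      have := runs_dataBit_val b { ρ₁ with mem := tagged vs ++ rest, mem2 := b :: ρ₁.mem2, st1 := [], st2 := [] } F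
        (by simp [hρ₁, hph]) (e := e) (fd := fd) (by simp [hρ₁, heqf]) (by simp [hρ₁, hfound])
      simpa [state, hρ₁, hρ₂] using this
    have hih := scan_valBits F vs ρ₂ e fd rest Rfin Bc (by simp [hρ₂]) (by simp [hρ₂]) (by simp [hρ₂])
      (by simp [hρ₂, hph]) (by simp [hρ₂, heqf]) (by simp [hρ₂, hfound]) (by
        have e2 : ({ ρ₂ with
              mem := rest, mem2 := (tagged vs).reverse ++ ρ₂.mem2
              val := (bif e && !fd then vs.reverse else []) ++ ρ₂.val } : St) =
            { ρ with
              mem := rest, mem2 := (tagged (b :: vs)).reverse ++ ρ.mem2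
              val := (bif e && !fd then (b :: vs).reverse else []) ++ ρ.val } := by
          cases e <;> cases fd <;> simp [hρ₂, tagged, List.append_assoc, hst1, hst2]
        rw [e2]; exact hcont)
    have hstep2 : Runs scanLoop (state ρ₁ F) Rfin ((1 + ((13 + 2) + 2)) + 2 + (vs.length * 27 + Bc)) := by
      cases b
      · exact Runs.loop_false hk2 h2 hih
      · exact Runs.loop_true hk2 h2 hih
    exact (Runs.loop_true hk1 h1 hstep2).of_eq rfl (by simp; ring_nf; omega)

/-- The item code in terms of `tagged`. [folklore] -/
theorem encItem_eq_tagged (v : List Bool) (s : Bool) : encItem v s = tagged v.reverse ++ [false, s] := rfl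

/-- **One entry.** Scanning an entry `(kk, v)` compares `kk` with the target, collects `v` if they
agree and nothing was found before, latches the match, and restores the target (continuation
form; `≤ (3 |key| + 14)` steps per code bit). [folklore] -/
theorem scan_entry (F : Regs AReg) (kk v : List Bool) (ρ : St) (fd : Bool) (rest : List Bool)
    (Rfin : Regs (K ⊕ AReg)) (Bc : ℕ)
    (hmem : ρ.mem = encItem kk.reverse false ++ encItem v true ++ rest) (hst1 : ρ.st1 = []) (hst2 : ρ.st2 = [])
    (hph : ρ.ph = []) (heqf : ρ.eqf = [true]) (hkey2 : ρ.key2 = []) (hfound : ρ.found = flag fd)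
    (hcont : Runs scanLoop (state
      { ρ with
        mem := rest, mem2 := (encItem kk.reverse false ++ encItem v true).reverse ++ ρ.mem2
        val := (bif decide (kk = ρ.key) && !fd then v else []) ++ ρ.val
        found := flag (fd || decide (kk = ρ.key)) } F) Rfin Bc) :
    Runs scanLoop (state ρ F) Rfin
      ((encItem kk.reverse false ++ encItem v true).length * (3 * ρ.key.length + 14) + Bc) := by
  set n := kk.length with hn
  set e1 := keyCmp true kk ρ.key with he1
  set e2 := (e1 && (ρ.key.drop n).isEmpty) with he2
  have he2' : e2 = decide (kk = ρ.key) := by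
    rw [he2, he1, hn, keyCmp_and_isEmpty, Bool.true_and]
  -- the states between the phases
  set ρA : St := { ρ with
    mem := false :: false :: (encItem v true ++ rest), mem2 := (tagged kk).reverse ++ ρ.mem2
    key := ρ.key.drop n, key2 := (ρ.key.take n).reverse ++ ρ.key2, eqf := flag e1 } with hρA
  set ρB : St := { ρA with mem := false :: (encItem v true ++ rest), mem2 := false :: ρA.mem2, st1 := [true], st2 := [] }
    with hρB
  set ρC : St := { ρB with
    mem := encItem v true ++ rest, mem2 := false :: ρB.mem2, st1 := [], ph := [true], eqf := flag e2
    key := ρA.key2.reverse ++ ρA.key, key2 := [] } with hρC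
  set ρD : St := { ρC with
    mem := [false, true] ++ rest, mem2 := (tagged v.reverse).reverse ++ ρC.mem2
    val := (bif e2 && !fd then v.reverse.reverse else []) ++ ρC.val } with hρD
  set ρD1 : St := { ρD with mem := true :: rest, mem2 := false :: ρD.mem2, st1 := [true], st2 := [] } with hρD1
  set ρE : St := { ρD1 with mem := rest, mem2 := true :: ρD1.mem2, st1 := [], ph := [], found := flag (fd || e2), eqf := [true] }
    with hρE
  -- phase 4: the terminator of the value item, then the continuation
  have hE : ρE = { ρ with
      mem := rest, mem2 := (encItem kk.reverse false ++ encItem v true).reverse ++ ρ.mem2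
      val := (bif decide (kk = ρ.key) && !fd then v else []) ++ ρ.val
      found := flag (fd || decide (kk = ρ.key)) } := by
    rw [← he2']
    simp [hρE, hρD1, hρD, hρC, hρB, hρA, encItem_eq_tagged, tagged, List.reverse_append, List.append_assoc,
      hst1, hst2, hph, heqf, hkey2]
  rw [← hE] at hcont
  have h4 : Runs scanLoop (state ρD F) Rfin (5 + 2 + ((1 + ((15 + 2) + 2)) + 2 + Bc)) := by
    have hk1 : state ρD F (Sum.inl K.mem) = false :: true :: rest := by simp [state, hρD]
    have t1 : Runs (scanBody false) (Function.update (state ρD F) (Sum.inl K.mem) (true :: rest)) (state ρD1 F) 5 := by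
      have := runs_scanBody_tag false { ρD with mem := true :: rest } F (by simp [hρD, hρC]) (by simp [hρD, hρC, hρB])
      simpa [state, hρD1, flag] using this
    have hk2 : state ρD1 F (Sum.inl K.mem) = true :: rest := by simp [state, hρD1]
    have t2 : Runs (scanBody true) (Function.update (state ρD1 F) (Sum.inl K.mem) rest) (state ρE F)
        (1 + ((15 + 2) + 2)) := by
      have hupd : Function.update (state ρD1 F) (Sum.inl K.mem) rest = state { ρD1 with mem := rest } F := by
        simp [state]
      rw [hupd]
      refine runs_scanBody_pair true _ F (by simp [hρD1]) (runs_afterTag_term true _ F (by simp [hρD1]) ?_)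
      have := runs_termBit_val { ρD1 with mem := rest, mem2 := true :: ρD1.mem2, st1 := [] } F
        (by simp [hρD1, hρD, hρC]) (e := e2) (fd := fd) (by simp [hρD1, hρD, hρC]) (by simp [hρD1, hρD, hρC, hρB, hρA, hfound])
      simpa [state, hρE] using this
    exact Runs.loop_false hk1 t1 (Runs.loop_true hk2 t2 hcont)
  -- phase 3: the value bits
  have h3 : Runs scanLoop (state ρC F) Rfin (v.reverse.length * 27 + (5 + 2 + ((1 + ((15 + 2) + 2)) + 2 + Bc))) :=
    scan_valBits F v.reverse ρC e2 fd ([false, true] ++ rest) Rfin _ (by simp [hρC, encItem_eq_tagged])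
      (by simp [hρC]) (by simp [hρC, hρB]) (by simp [hρC]) (by simp [hρC]) (by simp [hρC, hρB, hρA, hfound])
      (by simpa [hρD] using h4)
  -- phase 2: the terminator of the key item
  have h2 : Runs scanLoop (state ρA F) Rfin (5 + 2 + ((1 + ((3 * ρA.key2.length + 12 + 2) + 2)) + 2 +
      (v.reverse.length * 27 + (5 + 2 + ((1 + ((15 + 2) + 2)) + 2 + Bc))))) := by
    have hk1 : state ρA F (Sum.inl K.mem) = false :: false :: (encItem v true ++ rest) := by simp [state, hρA]
    have t1 : Runs (scanBody false) (Function.update (state ρA F) (Sum.inl K.mem) (false :: (encItem v true ++ rest)))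
        (state ρB F) 5 := by
      have := runs_scanBody_tag false { ρA with mem := false :: (encItem v true ++ rest) } F
        (by simp [hρA, hst1]) (by simp [hρA, hst2])
      simpa [state, hρB, flag] using this
    have hk2 : state ρB F (Sum.inl K.mem) = false :: (encItem v true ++ rest) := by simp [state, hρB]
    have t2 : Runs (scanBody false) (Function.update (state ρB F) (Sum.inl K.mem) (encItem v true ++ rest)) (state ρC F)
        (1 + ((3 * ρA.key2.length + 12 + 2) + 2)) := by
      have hupd : Function.update (state ρB F) (Sum.inl K.mem) (encItem v true ++ rest) =
          state { ρB with mem := encItem v true ++ rest } F := by simp [state]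
      rw [hupd]
      refine runs_scanBody_pair false _ F (by simp [hρB]) (runs_afterTag_term false _ F (by simp [hρB]) ?_)
      have := runs_termBit_key { ρB with mem := encItem v true ++ rest, mem2 := false :: ρB.mem2, st1 := [] } F
        (by simp [hρB, hρA, hph]) (e := e1) (by simp [hρB, hρA])
      simpa [state, hρC, hρB, he2] using this
    exact Runs.loop_false hk1 t1 (Runs.loop_false hk2 t2 h3)
  -- phase 1: the key bits
  have h1 := scan_keyBits F kk ρ true (false :: false :: (encItem v true ++ rest)) Rfin _
    (by simp [hmem, encItem_eq_tagged, List.append_assoc]) hst1 hst2 hph heqf (by simpa [hρA] using h2)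
  refine h1.of_eq rfl ?_
  -- the cost
  have hlen : (encItem kk.reverse false ++ encItem v true).length = 2 * kk.length + 2 * v.length + 4 := by
    simp [length_encItem]; ring
  rw [hlen]
  have lmin : min n ρ.key.length ≤ ρ.key.length := min_le_right _ _
  simp only [hkey2, List.length_nil, add_zero]
  nlinarith [lmin, Nat.zero_le kk.length, Nat.zero_le v.length, Nat.zero_le ρ.key.length]

/-- Whether a log has an entry with the given key. [folklore] -/
def logFound : List (List Bool × List Bool) → List Bool → Bool
  | [], _ => false
  | e :: E, k => decide (e.1 = k) || logFound E k

/-- **The whole log.** Scanning `encLog E` leaves `logLookup E key` on `val` (unless something had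
been found before), the reversed code on `mem2`, the match latched in `found`. [folklore] -/
theorem scan_log (F : Regs AReg) : ∀ (E : List (List Bool × List Bool)) (ρ : St) (fd : Bool),
    ρ.mem = encLog E → ρ.st1 = [] → ρ.st2 = [] → ρ.ph = [] → ρ.eqf = [true] → ρ.key2 = [] →
    ρ.found = flag fd → (fd = false → ρ.val = []) →
    Runs scanLoop (state ρ F)
      (state { ρ with
        mem := [], mem2 := (encLog E).reverse ++ ρ.mem2
        val := (bif fd then ρ.val else logLookup E ρ.key)
        found := flag (fd || logFound E ρ.key) } F)
      ((encLog E).length * (3 * ρ.key.length + 14) + 1)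
  | [], ρ, fd, hmem, hst1, hst2, hph, heqf, hkey2, hfound, hval => by
    refine (Runs.loop_nil _ _ (by simp [state, hmem])).of_eq ?_ (by simp)
    simp only [state]
    congr 1
    cases ρ; cases fd <;> simp_all [logLookup, logFound]
  | (kk, v) :: E, ρ, fd, hmem, hst1, hst2, hph, heqf, hkey2, hfound, hval => by
    set m := decide (kk = ρ.key) with hm
    set ρ' : St := { ρ with
      mem := encLog E, mem2 := (encItem kk.reverse false ++ encItem v true).reverse ++ ρ.mem2
      val := (bif m && !fd then v else []) ++ ρ.val, found := flag (fd || m) } with hρ'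
    have hih := scan_log F E ρ' (fd || m) (by simp [hρ']) (by simp [hρ', hst1]) (by simp [hρ', hst2])
      (by simp [hρ', hph]) (by simp [hρ', heqf]) (by simp [hρ', hkey2]) (by simp [hρ']) (by
        intro h
        simp only [Bool.or_eq_false_iff] at h
        obtain ⟨h1, h2⟩ := h
        simp [hρ', h1, h2, hval h1])
    have hent := scan_entry F kk v ρ fd (encLog E) _ _ (by simpa [List.append_assoc] using hmem) hst1 hst2 hph heqf
      hkey2 hfound (by simpa [hρ'] using hih)
    refine hent.of_eq ?_ ?_
    · simp only [state, List.reverse_append, List.append_assoc, encLog_cons, logFound, Bool.or_assoc]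
      congr 1
      cases fd
      · by_cases hkk : kk = ρ.key
        · simp [hm, hkk, logLookup, hval rfl]
        · simp [hm, hkk, logLookup, hval rfl]
      · simp [hm]
    · simp only [encLog_cons, List.length_append]
      ring_nf; omega

/-- **Simulation of `memRead`** (from clean scan registers): `val := logLookup E key`, everything
else restored, within `|encLog E| (3 |key| + 17) + 9` steps. [folklore] -/
theorem runs_memRead (ρ : St) (F : Regs AReg) (E : List (List Bool × List Bool)) (k : List Bool)
    (hmem : ρ.mem = encLog E) (hkey : ρ.key = k) (hmem2 : ρ.mem2 = []) (hkey2 : ρ.key2 = []) (hval : ρ.val = [])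
    (hst1 : ρ.st1 = []) (hst2 : ρ.st2 = []) (hph : ρ.ph = []) (heqf : ρ.eqf = []) (hfound : ρ.found = []) :
    Runs memRead (state ρ F) (state { ρ with val := logLookup E k } F)
      ((encLog E).length * (3 * k.length + 17) + 9) := by
  have h1 : Runs (push (Sum.inl K.eqf) true) (state ρ F) (state { ρ with eqf := [true] } F) 1 := by
    have := Runs.push (Sum.inl K.eqf) true (state ρ F)
    simpa [state, heqf] using this
  have h2 := scan_log F E { ρ with eqf := [true] } false (by simp [hmem]) (by simp [hst1]) (by simp [hst2])
    (by simp [hph]) (by simp) (by simp [hkey2]) (by simp [hfound]) (fun _ => by simp [hval])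
  simp only [Bool.false_or, cond_false] at h2
  have h3 := h2.seq ((runs_pour (a := (Sum.inl K.mem2 : K ⊕ AReg)) (b := Sum.inl K.mem) (by simp) _).seq
    ((runs_clear_flag (Sum.inl K.eqf) (by simp [state])).seq
      (runs_clear_flag (Sum.inl K.found) (by simp [state, length_flag_le]))))
  simp only [state, Sum.elim_inl, regs_mem2, regs_mem, List.append_nil, Sum.update_elim_inl, update_regs_mem2,
    update_regs_mem, update_regs_eqf, update_regs_found, List.length_append, List.length_reverse] at h3
  refine (h1.seq h3).of_eq ?_ ?_
  · simp [state, hmem, hmem2, hkey, heqf, hfound]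
  · rw [hmem2, hkey]; simp; ring_nf; omega

/-! ### The log as a memory -/

/-- `Represents E mem`: looking up the numeral of any address in the log `E` gives the numeral of
the memory contents (absent addresses hold `0 = encodeNat⁻¹ []`). [folklore] -/
def Represents (E : List (List Bool × List Bool)) (mem : ℕ → ℕ) : Prop :=
  ∀ a, logLookup E (encodeNat a) = encodeNat (mem a)

/-- The empty log represents the zero memory. [folklore] -/
theorem represents_nil : Represents [] fun _ => 0 := fun _ => by
  simp only [logLookup]; exact (show encodeNat 0 = [] by decide).symm

/-- Canonical numerals are equal iff their values are. [folklore] -/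
theorem encodeNat_eq_encodeNat_iff {a b : ℕ} : encodeNat a = encodeNat b ↔ a = b :=
  ⟨fun h => by rw [← bitsToNat_encodeNat a, h, bitsToNat_encodeNat], fun h => by rw [h]⟩

/-- **Writing is prepending**: the log with the new entry in front represents the updated memory.
[folklore] -/
theorem Represents.update {E : List (List Bool × List Bool)} {mem : ℕ → ℕ} (h : Represents E mem)
    (a v : ℕ) : Represents ((encodeNat a, encodeNat v) :: E) (Function.update mem a v) := by
  intro b
  simp only [logLookup, encodeNat_eq_encodeNat_iff]
  by_cases hab : a = b
  · subst hab; simp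
  · rw [if_neg hab, Function.update_of_ne (Ne.symm hab), h b]

/-- Reading through a representation. [folklore] -/
theorem Represents.lookup {E : List (List Bool × List Bool)} {mem : ℕ → ℕ} (h : Represents E mem) (a : ℕ) :
    logLookup E (encodeNat a) = encodeNat (mem a) := h a

/-- `BoundedLog β E`: every key and every value of the log has at most `β` bits. [folklore] -/
def BoundedLog (β : ℕ) (E : List (List Bool × List Bool)) : Prop :=
  ∀ e ∈ E, e.1.length ≤ β ∧ e.2.length ≤ β

/-- The code of a bounded log has length at most `(4 β + 4) |E|`. [folklore] -/
theorem length_encLog_le {β : ℕ} {E : List (List Bool × List Bool)} (h : BoundedLog β E) :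
    (encLog E).length ≤ (4 * β + 4) * E.length := by
  induction E with
  | nil => simp
  | cons e E ih =>
    have h1 := h e (by simp)
    have h2 := ih (fun e' he' => h e' (by simp [he']))
    simp only [encLog_cons, List.length_append, length_encItem, List.length_reverse, List.length_cons]
    nlinarith [h1.1, h1.2]

/-- Prepending a bounded entry keeps the log bounded. [folklore] -/
theorem BoundedLog.cons {β : ℕ} {E : List (List Bool × List Bool)} (h : BoundedLog β E) {k v : List Bool}
    (hk : k.length ≤ β) (hv : v.length ≤ β) : BoundedLog β ((k, v) :: E) := by
  intro e he
  rcases List.mem_cons.1 he with rfl | he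
  · exact ⟨hk, hv⟩
  · exact h e he

/-- Values read from a bounded log are bounded. [folklore] -/
theorem BoundedLog.length_logLookup_le {β : ℕ} {E : List (List Bool × List Bool)} (h : BoundedLog β E)
    (k : List Bool) : (logLookup E k).length ≤ β := by
  induction E with
  | nil => simp [logLookup]
  | cons e E ih =>
    simp only [logLookup]
    split_ifs
    · exact (h e (by simp)).2
    · exact ih (fun e' he' => h e' (by simp [he']))

end Literature.Computability.Cryptography.WordRAM.ToTM2
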